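import Summits.NavierStokesRegularity.NavierStokesRegularity.Theorems.EulerZoomLiouvillePowerGaugeEulerLiouvilleWeakPressureGradient
import Summits.NavierStokesRegularity.NavierStokesRegularity.Theorems.EulerZoomLiouvillePowerGaugeEulerLiouvilleSelfSimilarPastProfileEquations

/-!
# CIV (3.3) IN THE WEAK CLASS, III: member level (crux hypotheses verbatim + exact self-similarity)
# (crux `EulerZoomLiouville.PowerGaugeEulerLiouville` = stmt-NavierStokesRegularity-19832, line `birth`, open stub `stub_selfSimilarWeakRest`)

Width seat `ns-ezl-w1` (g6) under the crux LEAD, cell ns-regularity-ideate.  By-name assembly of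
`Past.profileData_of_past` (the profile-side data of a past-exact member: `V ∈ L⁶_loc`, whole-space weak gradient `G ∈ L²_loc`,
`P ∈ L^{3/2}_loc`, weak divergence-freeness, the weak profile equation) with `WeakPressure.hasWeakFDerivOn_pressure`:

* **`WeakPressure.hasWeakFDerivOn_pressure_of_past`** — for a suitable weak Euler pair on `(−∞,0) × ℝ³` with weak gradient `H` and
  the three power gauges at the origin (crux hypotheses verbatim, `0 < ρ ≤ ½`), exactly self-similar about `(T, x₀)` with profile
  `(V, P)` for `τ < T₁` (`T₁ ≤ 0`, `T₁ ≤ T`), there is a profile gradient `G` — a whole-space weak derivative of `V`, `L²` on every ball —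
  such that the PRESSURE PROFILE IS WEAKLY DIFFERENTIABLE with `∇P = −(1−γ)V − G(W)`, `W = γy + V`, `γ = 1/(2+ρ)`;
* **`WeakPressure.hasWeakFDerivOn_pressure_of_selfSimilar`** — the origin-centred form (binder shape of the skeleton's
  `IsExactlySelfSimilar`).

So every genuinely weak member of `stub_selfSimilarWeakRest` satisfies Constantin–Ignatova–Vicol's profile equation (3.3) POINTWISE A.E.,
with `P ∈ W^{1,1}_loc`; together with `…WeakBernoulliTransport*` (CIV (3.31) in `𝒟′`) this is the regularity-free Eulerian core of the
profile analysis.  WHAT THIS IS NOT: not NS, not E, not the stub — a weak-class TOOL (`--supports` stmt-19832); DENT 0; 19832 OPEN.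
[folklore; cf. ConstantinIgnatovaVicol2026Putative §3.1.1 (3.3)]
-/

noncomputable section

set_option linter.dupNamespace false
-- nested operator types (`innerSL … ∘L …`)
set_option maxSynthPendingDepth 3

open MeasureTheory Set Filter Topology Metric Function TopologicalSpace
open scoped ENNReal NNReal RealInnerProductSpace ContDiff

namespace Summit.NavierStokesRegularity.NavierStokesRegularity.Theorems.PowerGaugeEulerLiouville

open Literature.Analysis Literature.Analysis.FunctionSpaces Literature.Analysis.FluidPDE

namespace WeakPressure

/-- **THE WEAK PRESSURE-GRADIENT LAW OF A PAST-EXACT SELF-SIMILAR CLASS MEMBER** (`0 < ρ ≤ ½`, `γ = 1/(2+ρ)`; NO regularity of the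
profile): crux hypotheses verbatim, exact self-similarity about `(T, x₀)` for `τ < T₁` (`T₁ ≤ 0`, `T₁ ≤ T`) ⇒ there is a whole-space weak
derivative `G` of `V`, `L²` on every ball, with `HasWeakFDerivOn ⊤ volume P (x ↦ −⟪G x (W x) + (1−γ)V x, ·⟫)`. [folklore] -/
theorem hasWeakFDerivOn_pressure_of_past {ρ : ℝ} (hρ : 0 < ρ) (hρh : ρ ≤ 1 / 2)
    {T T₁ : ℝ} (hT₁ : T₁ ≤ 0) (hTT₁ : T₁ ≤ T) (x₀ : EuclideanSpace ℝ (Fin 3))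
    {u : ℝ → EuclideanSpace ℝ (Fin 3) → EuclideanSpace ℝ (Fin 3)} {p : ℝ → EuclideanSpace ℝ (Fin 3) → ℝ}
    {H : ℝ → EuclideanSpace ℝ (Fin 3) → EuclideanSpace ℝ (Fin 3) →L[ℝ] EuclideanSpace ℝ (Fin 3)} {c : ℝ≥0}
    (hsw : IsSuitableWeakSolutionOn (slab (EuclideanSpace ℝ (Fin 3)) (Iio 0) isOpen_Iio) 0 0 u p)
    (hH : HasWeakSpatialGradientOn (slab (EuclideanSpace ℝ (Fin 3)) (Iio 0) isOpen_Iio) u H)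
    (hgauge : ∀ a : ℝ, 0 < a →
      ENNReal.ofReal (a ^ (2 * ρ)) * cknA a (0 : ℝ × EuclideanSpace ℝ (Fin 3)) u +
          ENNReal.ofReal (a ^ ρ) * cknE a (0 : ℝ × EuclideanSpace ℝ (Fin 3)) H +
        ENNReal.ofReal (a ^ (2 * ρ)) * cknD a (0 : ℝ × EuclideanSpace ℝ (Fin 3)) p ≤ (c : ℝ≥0∞))
    {V : EuclideanSpace ℝ (Fin 3) → EuclideanSpace ℝ (Fin 3)} {P : EuclideanSpace ℝ (Fin 3) → ℝ}
    (hu : ∀ τ : ℝ, τ < T₁ → u τ = fun x => selfSimilarCollapse (1 / (2 + ρ)) T V τ (x - x₀))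
    (hp : ∀ τ : ℝ, τ < T₁ → p τ = fun x => selfSimilarCollapsePressure (1 / (2 + ρ)) T P τ (x - x₀)) :
    ∃ G : EuclideanSpace ℝ (Fin 3) → EuclideanSpace ℝ (Fin 3) →L[ℝ] EuclideanSpace ℝ (Fin 3),
      HasWeakFDerivOn (⊤ : Opens (EuclideanSpace ℝ (Fin 3))) volume V G ∧
      (∀ r : ℝ, MemLp G 2 (volume.restrict (ball (0 : EuclideanSpace ℝ (Fin 3)) r))) ∧
      HasWeakFDerivOn (⊤ : Opens (EuclideanSpace ℝ (Fin 3))) volume P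
        (fun x => -(innerSL ℝ (G x (selfSimilarTransport (1 / (2 + ρ)) 0 V x) + (1 - 1 / (2 + ρ)) • V x))) := by
  have hA : ∀ a : ℝ, 0 < a → ENNReal.ofReal (a ^ (2 * ρ)) *
      cknA a (0 : ℝ × EuclideanSpace ℝ (Fin 3)) u ≤ (c : ℝ≥0∞) :=
    fun a ha => le_trans (le_trans le_self_add le_self_add) (hgauge a ha)
  have hE : ∀ a : ℝ, 0 < a → ENNReal.ofReal (a ^ ρ) *
      cknE a (0 : ℝ × EuclideanSpace ℝ (Fin 3)) H ≤ (c : ℝ≥0∞) :=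
    fun a ha => le_trans (le_trans le_add_self le_self_add) (hgauge a ha)
  have hD : ∀ a : ℝ, 0 < a → ENNReal.ofReal (a ^ (2 * ρ)) *
      cknD a (0 : ℝ × EuclideanSpace ℝ (Fin 3)) p ≤ (c : ℝ≥0∞) :=
    fun a ha => le_trans le_add_self (hgauge a ha)
  obtain ⟨G, hVm, hPm, -, hVG, -, -, -, -, hV6, hG2, hP32, hdiv, heq, -, -⟩ :=
    Past.profileData_of_past hρ hρh hT₁ hTT₁ x₀ hsw.distributional hH hA hE hD hu hp
  exact ⟨G, hVG, hG2, hasWeakFDerivOn_pressure hVm hPm hV6 hVG hG2 hP32 hdiv heq⟩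

/-- **THE WEAK PRESSURE-GRADIENT LAW OF AN EXACTLY SELF-SIMILAR CLASS MEMBER (origin-centred; binder shape of the skeleton's
`IsExactlySelfSimilar`).**  Crux hypotheses verbatim, `0 < ρ ≤ ½`, `u(τ) = selfSimilarCollapse γ 0 V τ`, `p(τ) = selfSimilarCollapsePressure γ 0 P τ`
for `τ < 0`, `γ = 1/(2+ρ)` ⇒ some whole-space weak derivative `G` of `V` (`L²` on balls) makes `∇P = −(1−γ)V − G(W)` hold weakly:
CIV (3.3) pointwise a.e. for the weak profile. [folklore] -/
theorem hasWeakFDerivOn_pressure_of_selfSimilar {ρ : ℝ} (hρ : 0 < ρ) (hρh : ρ ≤ 1 / 2)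
    {u : ℝ → EuclideanSpace ℝ (Fin 3) → EuclideanSpace ℝ (Fin 3)} {p : ℝ → EuclideanSpace ℝ (Fin 3) → ℝ}
    {H : ℝ → EuclideanSpace ℝ (Fin 3) → EuclideanSpace ℝ (Fin 3) →L[ℝ] EuclideanSpace ℝ (Fin 3)} {c : ℝ≥0}
    (hsw : IsSuitableWeakSolutionOn (slab (EuclideanSpace ℝ (Fin 3)) (Iio 0) isOpen_Iio) 0 0 u p)
    (hH : HasWeakSpatialGradientOn (slab (EuclideanSpace ℝ (Fin 3)) (Iio 0) isOpen_Iio) u H)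
    (hgauge : ∀ a : ℝ, 0 < a →
      ENNReal.ofReal (a ^ (2 * ρ)) * cknA a (0 : ℝ × EuclideanSpace ℝ (Fin 3)) u +
          ENNReal.ofReal (a ^ ρ) * cknE a (0 : ℝ × EuclideanSpace ℝ (Fin 3)) H +
        ENNReal.ofReal (a ^ (2 * ρ)) * cknD a (0 : ℝ × EuclideanSpace ℝ (Fin 3)) p ≤ (c : ℝ≥0∞))
    {V : EuclideanSpace ℝ (Fin 3) → EuclideanSpace ℝ (Fin 3)} {P : EuclideanSpace ℝ (Fin 3) → ℝ}
    (hu : ∀ τ : ℝ, τ < 0 → u τ = selfSimilarCollapse (1 / (2 + ρ)) 0 V τ)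
    (hp : ∀ τ : ℝ, τ < 0 → p τ = selfSimilarCollapsePressure (1 / (2 + ρ)) 0 P τ) :
    ∃ G : EuclideanSpace ℝ (Fin 3) → EuclideanSpace ℝ (Fin 3) →L[ℝ] EuclideanSpace ℝ (Fin 3),
      HasWeakFDerivOn (⊤ : Opens (EuclideanSpace ℝ (Fin 3))) volume V G ∧
      (∀ r : ℝ, MemLp G 2 (volume.restrict (ball (0 : EuclideanSpace ℝ (Fin 3)) r))) ∧
      HasWeakFDerivOn (⊤ : Opens (EuclideanSpace ℝ (Fin 3))) volume P
        (fun x => -(innerSL ℝ (G x (selfSimilarTransport (1 / (2 + ρ)) 0 V x) + (1 - 1 / (2 + ρ)) • V x))) := by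
  have hu' : ∀ τ : ℝ, τ < 0 → u τ = fun x => selfSimilarCollapse (1 / (2 + ρ)) 0 V τ (x - 0) :=
    fun τ hτ => by rw [hu τ hτ]; funext x; rw [sub_zero]
  have hp' : ∀ τ : ℝ, τ < 0 → p τ = fun x => selfSimilarCollapsePressure (1 / (2 + ρ)) 0 P τ (x - 0) :=
    fun τ hτ => by rw [hp τ hτ]; funext x; rw [sub_zero]
  exact hasWeakFDerivOn_pressure_of_past hρ hρh le_rfl le_rfl 0 hsw hH hgauge hu' hp'

end WeakPressure

end Summit.NavierStokesRegularity.NavierStokesRegularity.Theorems.PowerGaugeEulerLiouville
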